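import Literature.Barriers.Schanuel.NesterenkoModularScopeValuesProofs
import Literature.Barriers.Schanuel.NesterenkoModularScopeAnalytic
import Mathlib.Analysis.Analytic.OfScalars
import Mathlib.Analysis.Analytic.Uniqueness
import HarnessLib

/-!
# Barrier (Schanuel) `NesterenkoModularScope`: from formal `q`-series identities to functions on `ℍ` and back (toward Mahler's theorem) — proofs only

`Literature/Barriers/Schanuel/NesterenkoModularScopeMahlerBridge.lean` — proofs-only bridge between
the formal composite `A(z, P, Q, R) ∈ ℂ⟦z⟧` (`ramanujanComposite`) and the function
`τ ↦ A(e^{2πiτ}, E₂(τ), E₄(τ), E₆(τ))` on `ℍ`, for the proof of Mahler's theorem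
(`Mahler1969_ramanujan_algIndep`). No new definitions. Content:

* `ramanujanPoint_cexp` — `(q, P(q), Q(q), R(q)) = (q, E₂(τ), E₄(τ), E₆(τ))` for `q = e^{2πiτ}`
  (LNM 1752 Ch. 3 §1, p. 27);
* `aeval_ramanujanPoint_eq_zero_of_ramanujanComposite_eq_zero` — a formal relation gives a
  relation between the functions on `|z| < 1`;
* `eq_zero_of_hasSum_of_forall_eq_zero` — a convergent power series vanishing on the punctured
  disc is zero (uniqueness of Taylor coefficients);
* `ramanujanComposite_rename_eq_zero_of_forall` — conversely, a relation between the functions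
  `E₂, E₄, E₆, e^{2πiτ}` on `ℍ` gives the formal relation.

## References

* [NesterenkoPhilippon2001] LNM 1752 (2001), Ch. 3 §1 (p. 27) (`E₂(τ) = P(e^{2πiτ})`, …) and §3
  property 3) (p. 32); Ch. 10 §5 (p. 163).
* [Mahler1969] K. Mahler, J. Austral. Math. Soc. 10 (1969) 445–450.
-/

noncomputable section

open UpperHalfPlane hiding I
open Filter Topology Complex ModularForm EisensteinSeries
open Literature.NumberTheory.Transcendental
open scoped Real MatrixGroups

namespace Literature.Barriers.Schanuel

/-! ### The point `(q, P(q), Q(q), R(q))` for `q = e^{2πiτ}` -/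

/-- `(q, P(q), Q(q), R(q)) = (q, E₂(τ), E₄(τ), E₆(τ))` for `q = e^{2πiτ}`.
[cite: NesterenkoPhilippon2001, Ch. 3 §1 (p. 27)] -/
theorem ramanujanPoint_cexp (τ : ℍ) :
    ramanujanPoint (cexp (2 * π * I * τ)) = ![cexp (2 * π * I * τ), E2 τ, E₄ τ, E₆ τ] := by
  unfold ramanujanPoint
  rw [ramanujanP_cexp, ramanujanQ_cexp, ramanujanR_cexp]

/-- Every `z` with `0 < |z| < 1` is `e^{2πiτ}` for some `τ ∈ ℍ`. [folklore] -/
theorem exists_upperHalfPlane_cexp_eq {z : ℂ} (hz0 : z ≠ 0) (hz1 : ‖z‖ < 1) :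
    ∃ τ : ℍ, cexp (2 * π * I * τ) = z := by
  have him : 0 < (Function.Periodic.invQParam 1 z).im := by
    rw [Function.Periodic.im_invQParam]
    have hlog : Real.log ‖z‖ < 0 := Real.log_neg (norm_pos_iff.mpr hz0) hz1
    have : -(1 : ℝ) / (2 * π) < 0 := by
      rw [neg_div]; exact neg_neg_of_pos (div_pos one_pos (by positivity))
    exact mul_pos_of_neg_of_neg this hlog
  refine ⟨⟨Function.Periodic.invQParam 1 z, him⟩, ?_⟩
  have h := Function.Periodic.qParam_right_inv (h := 1) one_ne_zero hz0
  rw [Function.Periodic.qParam] at h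
  simpa using h

/-! ### From formal identities to functions -/

/-- A formal relation `A(z, P, Q, R) = 0` gives `A(z, P(z), Q(z), R(z)) = 0` for `|z| < 1`.
[cite: NesterenkoPhilippon2001, Ch. 3 §3 property 3) (p. 32)] -/
theorem aeval_ramanujanPoint_eq_zero_of_ramanujanComposite_eq_zero {A : MvPolynomial (Fin 4) ℂ}
    (hA : ramanujanComposite A = 0) {z : ℂ} (hz : ‖z‖ < 1) :
    MvPolynomial.aeval (ramanujanPoint z) A = 0 := by
  have h := (hasSum_ramanujanComposite A hz).2
  simp only [hA, map_zero, zero_mul] at h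
  exact h.unique hasSum_zero

/-- In particular on `ℍ`: `A(e^{2πiτ}, E₂(τ), E₄(τ), E₆(τ)) = 0`. [cite: NesterenkoPhilippon2001, Ch. 3 §1 (p. 27)] -/
theorem aeval_cexp_eq_zero_of_ramanujanComposite_eq_zero {A : MvPolynomial (Fin 4) ℂ}
    (hA : ramanujanComposite A = 0) (τ : ℍ) :
    MvPolynomial.aeval (![cexp (2 * π * I * τ), E2 τ, E₄ τ, E₆ τ] : Fin 4 → ℂ) A = 0 := by
  rw [← ramanujanPoint_cexp]
  exact aeval_ramanujanPoint_eq_zero_of_ramanujanComposite_eq_zero hA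
    (UpperHalfPlane.norm_exp_two_pi_I_lt_one τ)

/-! ### Uniqueness of Taylor coefficients -/

/-- A power series converging (absolutely) on `|z| < 1` to a function vanishing for `0 < |z| < 1`
has all its coefficients zero. [folklore] -/
theorem eq_zero_of_hasSum_of_forall_eq_zero {a : ℕ → ℂ} {f : ℂ → ℂ}
    (hsum : ∀ z : ℂ, ‖z‖ < 1 →
      Summable (fun n => ‖a n * z ^ n‖) ∧ HasSum (fun n => a n * z ^ n) (f z))
    (hf : ∀ z : ℂ, z ≠ 0 → ‖z‖ < 1 → f z = 0) : a = 0 := by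
  set p : FormalMultilinearSeries ℂ ℂ ℂ := FormalMultilinearSeries.ofScalars ℂ a with hp
  -- radius ≥ 1/2
  have e1 : ‖(1 / 2 : ℂ)‖ = 1 / 2 := by simp
  have e2 : ((1 / 2 : NNReal) : ℝ) = 1 / 2 := by simp
  have hrad : ((1 / 2 : NNReal) : ENNReal) ≤ p.radius := by
    apply FormalMultilinearSeries.le_radius_of_summable
    have h := (hsum (1 / 2 : ℂ) (by rw [e1]; norm_num)).1
    refine h.congr fun n => ?_
    rw [hp, FormalMultilinearSeries.ofScalars_norm, norm_mul, norm_pow, e1, e2]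
  have hball : HasFPowerSeriesOnBall f p 0 (1 / 2 : NNReal) := by
    refine ⟨hrad, by norm_num, fun {y} hy => ?_⟩
    rw [zero_add]
    have hy' : ‖y‖ < 1 := by
      rw [Metric.mem_eball, edist_zero_right] at hy
      have : (‖y‖₊ : ENNReal) < (1 / 2 : NNReal) := hy
      have h2 : ‖y‖₊ < (1 / 2 : NNReal) := by exact_mod_cast this
      have h3 : ‖y‖ < 1 / 2 := by
        have := NNReal.coe_lt_coe.mpr h2
        rw [coe_nnnorm, e2] at this
        exact this
      linarith
    have h := (hsum y hy').2
    have e : (fun n => p n (fun _ => y)) = fun n => a n * y ^ n := by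
      funext n
      rw [hp, FormalMultilinearSeries.ofScalars_apply_eq, smul_eq_mul]
    rw [e]
    exact h
  have hat : HasFPowerSeriesAt f p 0 := hball.hasFPowerSeriesAt
  have hcont : ContinuousAt f 0 := hat.continuousAt
  have hpunct : ∀ᶠ z in 𝓝[≠] (0 : ℂ), f z = 0 := by
    rw [eventually_nhdsWithin_iff]
    filter_upwards [Metric.ball_mem_nhds (0 : ℂ) one_pos] with z hz hne
    exact hf z hne (by simpa using hz)
  have hf0 : f 0 = 0 := by
    have h1 : Tendsto f (𝓝[≠] 0) (𝓝 (f 0)) := hcont.tendsto.mono_left nhdsWithin_le_nhds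
    have h2 : Tendsto f (𝓝[≠] 0) (𝓝 0) :=
      tendsto_const_nhds.congr' (hpunct.mono fun z hz => hz.symm)
    exact tendsto_nhds_unique h1 h2
  have hzero : f =ᶠ[𝓝 0] 0 := by
    filter_upwards [Metric.ball_mem_nhds (0 : ℂ) one_pos] with z hz
    by_cases h0 : z = 0
    · rw [h0, hf0]; rfl
    · exact hf z h0 (by simpa using hz)
  have hp0 : p = 0 := (hat.congr hzero).eq_zero
  rw [hp] at hp0
  exact (FormalMultilinearSeries.ofScalars_series_eq_zero ℂ).mp hp0

/-! ### From functions on `ℍ` back to formal identities -/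

/-- **A relation between `e^{2πiτ}, E₂, E₄, E₆` on `ℍ` is a formal relation between
`z, P, Q, R`** (the values `q = e^{2πiτ}`, `τ ∈ ℍ`, fill the punctured unit disc, on which the
composite is a convergent power series). Stated for a polynomial in any subset of the four
variables (`rename g`). [cite: NesterenkoPhilippon2001, Ch. 3 §1 (p. 27) and §3 3) (p. 32)] -/
theorem ramanujanComposite_rename_eq_zero_of_forall {m : ℕ} (g : Fin m → Fin 4)
    (T : MvPolynomial (Fin m) ℂ)
    (h : ∀ τ : ℍ, MvPolynomial.aeval
      (fun j => (![cexp (2 * π * I * τ), E2 τ, E₄ τ, E₆ τ] : Fin 4 → ℂ) (g j)) T = 0) :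
    ramanujanComposite (MvPolynomial.rename g T) = 0 := by
  have key : (fun n => PowerSeries.coeff n (ramanujanComposite (MvPolynomial.rename g T))) = 0 := by
    apply eq_zero_of_hasSum_of_forall_eq_zero
      (f := fun z => MvPolynomial.aeval (ramanujanPoint z) (MvPolynomial.rename g T))
    · intro z hz
      exact hasSum_ramanujanComposite _ hz
    · intro z hz0 hz1
      obtain ⟨τ, hτ⟩ := exists_upperHalfPlane_cexp_eq hz0 hz1
      show MvPolynomial.aeval (ramanujanPoint z) (MvPolynomial.rename g T) = 0
      rw [← hτ, MvPolynomial.aeval_rename, ramanujanPoint_cexp]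
      exact h τ
  ext n
  have := congrFun key n
  simpa using this

/-- The same bridge in the other direction for renamed polynomials: a formal relation gives the
relation on `ℍ`. [cite: NesterenkoPhilippon2001, Ch. 3 §1 (p. 27)] -/
theorem aeval_cexp_rename_eq_zero_of_ramanujanComposite_eq_zero {m : ℕ} (g : Fin m → Fin 4)
    {T : MvPolynomial (Fin m) ℂ} (hT : ramanujanComposite (MvPolynomial.rename g T) = 0) (τ : ℍ) :
    MvPolynomial.aeval (fun j => (![cexp (2 * π * I * τ), E2 τ, E₄ τ, E₆ τ] : Fin 4 → ℂ) (g j)) T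
      = 0 := by
  have h := aeval_cexp_eq_zero_of_ramanujanComposite_eq_zero hT τ
  rwa [MvPolynomial.aeval_rename] at h

/-- And at an arbitrary point of the disc: a formal relation for a renamed polynomial gives the
relation between the values `(z, P(z), Q(z), R(z))`. [cite: NesterenkoPhilippon2001, Ch. 3 §3 3) (p. 32)] -/
theorem aeval_ramanujanPoint_rename_eq_zero {m : ℕ} (g : Fin m → Fin 4)
    {T : MvPolynomial (Fin m) ℂ} (hT : ramanujanComposite (MvPolynomial.rename g T) = 0)
    {z : ℂ} (hz : ‖z‖ < 1) :
    MvPolynomial.aeval (fun j => ramanujanPoint z (g j)) T = 0 := by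
  have h := aeval_ramanujanPoint_eq_zero_of_ramanujanComposite_eq_zero hT hz
  rwa [MvPolynomial.aeval_rename] at h

/-- The composite of a renamed polynomial is the `aeval` at the renamed generators. [folklore] -/
theorem ramanujanComposite_rename {m : ℕ} (g : Fin m → Fin 4) (T : MvPolynomial (Fin m) ℂ) :
    ramanujanComposite (MvPolynomial.rename g T) =
      MvPolynomial.aeval (fun j => (![PowerSeries.X, (ramanujanPSeries).map (Int.castRingHom ℂ),
        (ramanujanQSeries).map (Int.castRingHom ℂ), (ramanujanRSeries).map (Int.castRingHom ℂ)] :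
          Fin 4 → PowerSeries ℂ) (g j)) T := by
  unfold ramanujanComposite
  rw [MvPolynomial.aeval_rename]
  rfl

end Literature.Barriers.Schanuel

end
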